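import Literature.NumberTheory.GaloisRepresentations.EisensteinSexticPlaces
import Literature.NumberTheory.GaloisRepresentations.CubicReciprocitySplitPrime
import Literature.NumberTheory.GaloisRepresentations.QuarticTwistGrossencharakterRamification
import Literature.NumberTheory.LFunctions.PrimesInRayClasses
import HarnessLib

/-!
# Auxiliary primes in a congruence class, and Eisenstein reciprocity at an auxiliary prime — the engine behind the conductor of the
# Größencharakter `𝔭 ↦ (k/N𝔭)(4k/𝔭)₃ϖ_𝔭` of `y² = x³ + k` (Ireland–Rosen Ch. 9 Thm. 1, Ch. 18 §7; Landau 1918)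

Topic `Literature/NumberTheory/GaloisRepresentations`, namespace `Literature.NumberTheory.GaloisRepresentations.EisensteinSextic` (sequel of
`EisensteinSexticHeckeCharacter` / `EisensteinSexticPlaces`, seat bed-w1; this file and its sequels `EisensteinSexticRamification*` are the
«FILE C» of the Deuring row `j = 0`, cell `bsd-wall`, seat bed-w3 g17).  THEOREMS only (no definition, no instance, no named fact), all
unconditional.  To show that the Hecke character `heckeOfGross ψ` of `E^k` is RAMIFIED at a prime `𝔭_w ∣ 36k`, `𝔭_w ∤ 3`, one needs an
element `a ≡ 1` modulo the other prime powers of `(36k)` with `ψ̃((a)) ≠ a` (`not_isUnramifiedAt_heckeOfGross_of_ne`).  We take for `a` the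
generator `ϖ` of an AUXILIARY principal prime `𝔮 = (ϖ)` of degree one in a prescribed class modulo `36k` (Landau), so that the cubic factor
`(4k/(ϖ))₃ = χ_𝔮(4k)` is a cubic residue symbol at ONE prime, computable by Eisenstein's reciprocity law prime by prime.  No composite cubic
reciprocity is needed.

* §4 `exists_prime_generator_sub_mem` — for `𝔪 ≠ 0` and `g₀` prime to `𝔪`: a prime `𝔮 = (ϖ) ∤ 𝔪` of prime norm with `ϖ ≡ g₀ (mod 𝔪)`, avoiding
  any finite set (Landau's primes of degree one in narrow ray classes, tree `exists_rayClassRel_prime_absNorm_not_mem`, applied to the class of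
  the principal ideal `(g₀)`: `(c)𝔮 = (b)(g₀)` with `b ≡ c`).
* §5 `exists_eq_mul_pow_modulusExp` (`𝔣 = J_w·𝔭_w^{n_w}`, `J_w` prime to `𝔭_w`), `exists_sub_one_mem_and_sub_mem` (CRT element).
* §6 ★ `cubicResidueSymbol_eq_one_of_sub_one_mem` (`ϖ ≡ 1 (mod 9m) ⇒ χ_{(ϖ)}(m) = 1`: periodicity of `(m/·)₃` = Artin reciprocity for `K(∛m)/K`,
  tree `artinSymbol_cubicLoc_span_eq_of_sub_mem`), `exists_cubicResidueSymbol_ne_one` (a non-cube mod `𝔭 ∤ 3`), ★ Eisenstein reciprocity at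
  the auxiliary prime: `cubicResidueSymbol_natCast_eq_of_residueCard_eq_sq` (inert `p`: `χ_𝔮(p) = χ_{(p)}(J(χ_𝔮,χ_𝔮)) = χ_{(p)}(ϖ)`) and
  `cubicResidueSymbol_natCast_eq_of_residueCard_eq` (split `p`: `χ_𝔮(p)·χ_w(N𝔮·J) = 1`), from the tree's Gauss-sum proofs
  (`CubicReciprocityRationalPrime`, `CubicReciprocitySplitPrime`, `J(χ_𝔮,χ_𝔮) = −ϖ`); ★★ `cubicResidueSymbol_intCast_eq_pow` — for a general
  `D = p^v·m` (`p ≠ 3`; the sextic twists use `D = 4k`, the good-at-`2` class an odd `D`): `ϖ ≡ 1 (mod 9m)`, `ϖ ≡ g (mod 𝔭_w)` ⇒ `χ_𝔮(D) = χ_w(g)^v`.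

Nothing about BSD is proved here; no modularity is used.

## References
* K. Ireland, M. Rosen, *A Classical Introduction to Modern Number Theory*, 2nd ed., GTM 84 (1990), Ch. 5 §2 (Jacobi symbol, reciprocity),
  Ch. 9 §1 (`ℤ[ω]`), §3 Theorem 1 (cubic reciprocity) with §4 (proof), Ch. 18 §3 Theorem 4, §6 Theorem 7 (proof: «`χ` is a Hecke character
  … with conductor dividing `12D`»), §7 («if `P ∣ 6D` define `χ(P) = 0`», Theorem 4′). [IrelandRosen1990]
* J. Neukirch, *Algebraic Number Theory* (1999), Ch. I §3, Ch. VI §1 (1.7)–(1.9), Ch. VII §6 (6.13)–(6.14), §13 (13.2). [NeukirchANT1999]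
* E. Landau, *Über Ideale und Primideale in Idealklassen*, Math. Z. 2 (1918), §1. [Landau1918Idealklassen]
* J. H. Silverman, *Advanced Topics in the Arithmetic of Elliptic Curves* (1994), II Thm. 9.2, Thm. 10.5. [SilvermanATAEC1994]

## Mathlib / tree search
Tree: `exists_rayClassRel_prime_absNorm_not_mem`, `RayClassRel`, `CoprimeIdeal` (`LFunctions/PrimesInRayClasses`, `RayClasses`); `modulusExp`,
`modulusExp_ne_zero_iff`, `pow_modulusExp_dvd` (`HeckeCharacterOfRayClass`, `RayClassGroup`); `isCoprime_span_singleton_of_sub_one_mem`,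
`isCoprime_span_singleton_asIdeal_of_not_mem` (`QuarticTwistGrossencharakterRamification`); `cubicLoc`, `coe_cubicLoc_of_not_mem`,
`artinSymbol_cubicLoc_span_eq_of_sub_mem`, `three_not_mem_of_natCast_mem` (`EisensteinSexticPrimes`, `CubicReciprocityRationalPrime`);
`residueCard_eq_of_mod_three_eq_one`, `asIdeal_eq_span_of_mod_three_eq_two`, `absNorm_span_intCast` (`EisensteinSexticPlaces`); `cubicResidueSymbol_*`
(`CubicResidueSymbol`), `cubicJacobiSum_eq_neg_of_span_eq` (`CubicJacobiSumPrimary`), `cubicResidueSymbol_natCast_eq_cubicResidueSymbol_cubicJacobiSum`,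
`cubicResidueSymbol_natCast_mul_cubicResidueSymbol_eq_one`; `artinSymbol_asIdeal`, `artinSymbol_top`.  Mathlib: `Ideal.isCoprime_iff_exists`,
`mul_left_cancel₀` (ideals of a Dedekind domain), `Associates.prime_pow_dvd_iff_le`, `IsCyclic.exists_generator`, `orderOf_eq_card_of_forall_mem_zpowers`,
`Nat.card_units`.  `lean search 'exists_prime_generator|auxiliary prime|cubicResidueSymbol_intCast'`: no prior statement of these lemmas.
-/

noncomputable section

open NumberField IsDedekindDomain IsDedekindDomain.HeightOneSpectrum
open scoped NumberTheorySymbols ComplexConjugate Pointwise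

namespace Literature.NumberTheory.GaloisRepresentations.EisensteinSextic

open Literature.NumberTheory.GaloisRepresentations
open Literature.NumberTheory.LFunctions (idealPow isCoprime_span_of_sub_mem RayClassRel CoprimeIdeal
  exists_rayClassRel_prime_absNorm_not_mem)
open Literature.NumberTheory.LFunctions.AbelianDensity (artinSymbol artinSymbol_asIdeal)
open Literature.NumberTheory.Automorphic (RingOfIntegers.coe_algEquiv_smul HeightOneSpectrum.smul_mem_smul_asIdeal_iff)

variable {K : Type} [Field K] [NumberField K]

/-! ### §4 An auxiliary degree-one prime with a generator in a prescribed class `mod 𝔪` (Landau) -/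

section AuxPrime

/-- **A prime `𝔮 = (ϖ)` of prime norm with `ϖ ≡ g₀ (mod 𝔪)`**, avoiding any finite set of places: for `𝔪 ≠ 0` and `g₀ ≠ 0`
prime to `𝔪` there is a principal prime `𝔮 = (ϖ) ∤ 𝔪`, `N𝔮` a rational prime, with `ϖ − g₀ ∈ 𝔪`.  Landau's theorem on primes
of degree one in narrow ray classes (tree `exists_rayClassRel_prime_absNorm_not_mem`, class of the principal ideal `(g₀)`):
`(c)𝔮 = (b)(g₀)` with `b ≡ c (mod 𝔪)`, `c` prime to `𝔪`, so `𝔮 = (ϖ)` with `cϖ = b g₀`, and `c(ϖ − g₀) = (b − c)g₀ ∈ 𝔪` gives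
`ϖ ≡ g₀`. [cite: Landau1918Idealklassen, §1 Satz] [cite: NeukirchANT1999, Ch. VI §1 Def. (1.7), Ch. VII §13 (13.2)] -/
theorem exists_prime_generator_sub_mem {𝔪 : Ideal (𝓞 K)} (h𝔪 : 𝔪 ≠ ⊥) {g₀ : 𝓞 K} (hg₀ : g₀ ≠ 0)
    (hcop : IsCoprime (Ideal.span {g₀}) 𝔪) (S : Set (HeightOneSpectrum (𝓞 K))) (hS : S.Finite) :
    ∃ (ϖ : 𝓞 K) (𝔮 : HeightOneSpectrum (𝓞 K)), 𝔮 ∉ S ∧ Ideal.span {ϖ} = 𝔮.asIdeal ∧ ϖ - g₀ ∈ 𝔪 ∧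
      (Ideal.absNorm 𝔮.asIdeal).Prime ∧ ¬ 𝔪 ≤ 𝔮.asIdeal := by
  have hb0 : (Ideal.span {g₀} : Ideal (𝓞 K)) ≠ ⊥ := by rwa [Ne, Ideal.span_singleton_eq_bot]
  obtain ⟨𝔮, h𝔮S, h𝔮𝔪, hrel, hprime⟩ :=
    exists_rayClassRel_prime_absNorm_not_mem h𝔪 (⟨Ideal.span {g₀}, hb0, hcop⟩ : CoprimeIdeal 𝔪) S hS
  obtain ⟨b, c, hb, hc, hccop, hbc, -, heq⟩ := hrel
  -- `b g₀ ∈ (c)·𝔮 ⊆ (c)`: `b g₀ = c ϖ`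
  have heq' : Ideal.span {c} * 𝔮.asIdeal = Ideal.span {b * g₀} := by
    rw [heq]; exact Ideal.span_singleton_mul_span_singleton b g₀
  have hmem : b * g₀ ∈ Ideal.span {c} * 𝔮.asIdeal := by
    rw [heq']; exact Ideal.mem_span_singleton_self _
  obtain ⟨ϖ, hϖ⟩ : c ∣ b * g₀ := Ideal.mem_span_singleton.mp (Ideal.mul_le_right hmem)
  have h𝔮eq : Ideal.span {ϖ} = 𝔮.asIdeal := by
    have h1 : Ideal.span {c} * 𝔮.asIdeal = Ideal.span {c} * Ideal.span {ϖ} := by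
      rw [heq', Ideal.span_singleton_mul_span_singleton, hϖ]
    have hc0 : (Ideal.span {c} : Ideal (𝓞 K)) ≠ 0 := by
      rw [Ne, Ideal.zero_eq_bot, Ideal.span_singleton_eq_bot]; exact hc
    exact (mul_left_cancel₀ hc0 h1).symm
  refine ⟨ϖ, 𝔮, h𝔮S, h𝔮eq, ?_, hprime, h𝔮𝔪⟩
  -- `c (ϖ − g₀) = (b − c) g₀ ∈ 𝔪` and `c` is a unit modulo `𝔪`
  obtain ⟨i, hi, j, hj, hij⟩ := Ideal.isCoprime_iff_exists.mp hccop
  obtain ⟨y, rfl⟩ := Ideal.mem_span_singleton'.mp hi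
  have h2 : c * (ϖ - g₀) ∈ 𝔪 := by
    have : c * (ϖ - g₀) = (b - c) * g₀ := by rw [mul_sub, ← hϖ]; ring
    rw [this]; exact 𝔪.mul_mem_right _ hbc
  have : ϖ - g₀ = y * (c * (ϖ - g₀)) + j * (ϖ - g₀) := by linear_combination -(ϖ - g₀) * hij
  rw [this]
  exact 𝔪.add_mem (𝔪.mul_mem_left _ h2) (𝔪.mul_mem_right _ hj)

end AuxPrime

/-! ### §5 Modulus bookkeeping: `𝔣 = J_w · 𝔭_w^{n_w}` with `J_w` prime to `𝔭_w`, and a CRT element -/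

section Modulus

/-- **`𝔣 = J_w · 𝔭_w^{n_w}` with `J_w` prime to `𝔭_w`** (`n_w = ord_w 𝔣`; unique factorisation of ideals).
[cite: NeukirchANT1999, Ch. I §3 Thm. (3.3)] -/
theorem exists_eq_mul_pow_modulusExp {𝔣 : Ideal (𝓞 K)} (h𝔣 : 𝔣 ≠ ⊥) (w : HeightOneSpectrum (𝓞 K)) :
    ∃ J : Ideal (𝓞 K), 𝔣 = J * w.asIdeal ^ modulusExp 𝔣 w ∧ IsCoprime J w.asIdeal := by
  obtain ⟨J, hJ⟩ := pow_modulusExp_dvd (𝔪 := 𝔣) w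
  refine ⟨J, hJ.trans (mul_comm _ _), ?_⟩
  rw [Ideal.isCoprime_iff_sup_eq]
  by_contra hne
  have hle : J ≤ w.asIdeal := le_sup_left.trans (w.isMaximal.eq_of_le hne le_sup_right).symm.le
  obtain ⟨J', hJ'⟩ := Ideal.dvd_iff_le.mpr hle
  have hdvd : w.asIdeal ^ (modulusExp 𝔣 w + 1) ∣ 𝔣 := by
    refine ⟨J', ?_⟩
    calc 𝔣 = w.asIdeal ^ modulusExp 𝔣 w * J := hJ
      _ = w.asIdeal ^ modulusExp 𝔣 w * (w.asIdeal * J') := by rw [hJ']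
      _ = w.asIdeal ^ (modulusExp 𝔣 w + 1) * J' := by rw [pow_succ, mul_assoc]
  have h2 := (Associates.prime_pow_dvd_iff_le (Associates.mk_ne_zero.mpr h𝔣) w.associates_irreducible).mp
    (by rw [← Associates.mk_pow, Associates.mk_le_mk_iff_dvd]; exact hdvd)
  have h3 : modulusExp 𝔣 w + 1 ≤ modulusExp 𝔣 w := by unfold modulusExp; exact h2
  omega

omit [NumberField K] in
/-- **CRT element**: for `J` prime to `𝔭_w^n` and any `g`, an integer `g₀ ≡ 1 (mod J)`, `g₀ ≡ g (mod 𝔭_w^n)`.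
[cite: NeukirchANT1999, Ch. I §3 Thm. (3.6)] -/
theorem exists_sub_one_mem_and_sub_mem {J I : Ideal (𝓞 K)} (hJI : IsCoprime J I) (g : 𝓞 K) :
    ∃ g₀ : 𝓞 K, g₀ - 1 ∈ J ∧ g₀ - g ∈ I := by
  obtain ⟨α, hα, β, hβ, hαβ⟩ := Ideal.isCoprime_iff_exists.mp hJI
  refine ⟨β + α * g, ?_, ?_⟩
  · have : β + α * g - 1 = α * (g - 1) := by linear_combination hαβ
    rw [this]; exact J.mul_mem_right _ hα
  · have : β + α * g - g = β * (1 - g) := by linear_combination g * hαβ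
    rw [this]; exact I.mul_mem_right _ hβ

end Modulus


/-! ### §6 The cubic symbol at an auxiliary prime: periodicity kills the cofactor, Eisenstein reciprocity moves `χ_𝔮(p)` to `χ_w(ϖ)` -/

section Cubic

variable {ζ : 𝓞 K} (hζ : IsPrimitiveRoot ζ 3)

omit [NumberField K] in
/-- If `𝔮 + (y) = 1` and `z ∣ y` then `z ∉ 𝔮`. [cite: NeukirchANT1999, Ch. I §3 Thm. (3.6)] -/
theorem not_mem_of_isCoprime_span_of_dvd {𝔮 : HeightOneSpectrum (𝓞 K)} {y z : 𝓞 K}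
    (h : IsCoprime 𝔮.asIdeal (Ideal.span {y})) (hzy : z ∣ y) : z ∉ 𝔮.asIdeal := by
  intro hz
  obtain ⟨t, rfl⟩ := hzy
  have hy : z * t ∈ 𝔮.asIdeal := 𝔮.asIdeal.mul_mem_right _ hz
  rw [Ideal.isCoprime_iff_sup_eq, sup_eq_left.mpr ((Ideal.span_singleton_le_iff_mem _).mpr hy)] at h
  exact 𝔮.isPrime.ne_top h

include hζ in
/-- `χ_𝔭(a^n) = χ_𝔭(a)^n` (`𝔭 ∤ 3`). [cite: IrelandRosen1990, Ch. 9 §3 Prop. 9.3.3 (c)] -/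
theorem cubicResidueSymbol_pow {𝔭 : HeightOneSpectrum (𝓞 K)} (h3 : (3 : 𝓞 K) ∉ 𝔭.asIdeal) (a : 𝓞 K ⧸ 𝔭.asIdeal) (n : ℕ) :
    cubicResidueSymbol 𝔭 (a ^ n) = cubicResidueSymbol 𝔭 a ^ n := by
  induction n with
  | zero => rw [pow_zero, pow_zero, cubicResidueSymbol_one hζ h3]
  | succ n ih => rw [pow_succ, pow_succ, cubicResidueSymbol_mul hζ, ih]

include hζ in
/-- ★ **Periodicity kills the cofactor**: if `𝔮 = (ϖ)` with `ϖ ≡ 1 (mod 9m)`, `m ≠ 0`, then `χ_𝔮(m) = 1` — the Artin symbol of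
`K(∛m)/K` at `(ϖ)` equals that at `(1)` (tree `artinSymbol_cubicLoc_span_eq_of_sub_mem`, Artin reciprocity with modulus `9m`), and at the
prime `𝔮 ∤ 3m` it is `χ_𝔮(m)` (`coe_cubicLoc_of_not_mem`). [cite: IrelandRosen1990, Ch. 9 §3 Theorem 1] [cite: NeukirchANT1999, Ch. VII §6 Cor. (6.14)] -/
theorem cubicResidueSymbol_eq_one_of_sub_one_mem {m : 𝓞 K} {ϖ : 𝓞 K} {𝔮 : HeightOneSpectrum (𝓞 K)}
    (hϖ : Ideal.span {ϖ} = 𝔮.asIdeal) (h1 : ϖ - 1 ∈ Ideal.span {9 * m}) :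
    (3 : 𝓞 K) ∉ 𝔮.asIdeal ∧ m ∉ 𝔮.asIdeal ∧ cubicResidueSymbol 𝔮 (Ideal.Quotient.mk 𝔮.asIdeal m) = 1 := by
  obtain ⟨w₀⟩ : Nonempty (InfinitePlace K) := inferInstance
  have hϖ0 : ϖ ≠ 0 := fun h => 𝔮.ne_bot (by rw [← hϖ, h, Ideal.span_singleton_eq_bot])
  have hcop : IsCoprime 𝔮.asIdeal (Ideal.span {9 * m}) := by
    have h := isCoprime_span_singleton_of_sub_one_mem h1
    rwa [hϖ] at h
  have h3 : (3 : 𝓞 K) ∉ 𝔮.asIdeal := not_mem_of_isCoprime_span_of_dvd hcop ⟨3 * m, by ring⟩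
  have hm𝔮 : m ∉ 𝔮.asIdeal := not_mem_of_isCoprime_span_of_dvd hcop ⟨9, by ring⟩
  refine ⟨h3, hm𝔮, ?_⟩
  have hcop1 : IsCoprime (Ideal.span {(1 : 𝓞 K)}) (Ideal.span {3 * m}) := by
    rw [Ideal.span_singleton_one, ← Ideal.one_eq_top]; exact isCoprime_one_left
  have hS := artinSymbol_cubicLoc_span_eq_of_sub_mem hζ w₀.embedding hϖ0 one_ne_zero hcop1 h1
  rw [Ideal.span_singleton_one, Literature.NumberTheory.LFunctions.artinSymbol_top, hϖ, artinSymbol_asIdeal] at hS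
  have h := coe_cubicLoc_of_not_mem hζ w₀.embedding hm𝔮 h3
  rw [hS, Units.val_one] at h
  have h' : (cubicResidueSymbol 𝔮 (Ideal.Quotient.mk 𝔮.asIdeal m) : K) = 1 :=
    w₀.embedding.injective (by rw [map_one]; exact h.symm)
  exact_mod_cast h'

include hζ in
/-- **A non-cube modulo `𝔭 ∤ 3`**: some `g ∉ 𝔭` has `χ_𝔭(g) ≠ 1` (a generator of the cyclic group `(𝓞/𝔭)ˣ` of order `N𝔭 − 1`,
`3 ∣ N𝔭 − 1`, has `g^{(N𝔭−1)/3} ≠ 1`). [cite: IrelandRosen1990, Ch. 9 §3 Prop. 9.3.3 (b) and Ch. 7 §1 (cyclicity)] -/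
theorem exists_cubicResidueSymbol_ne_one {w : HeightOneSpectrum (𝓞 K)} (h3 : (3 : 𝓞 K) ∉ w.asIdeal) :
    ∃ g : 𝓞 K, g ∉ w.asIdeal ∧ cubicResidueSymbol w (Ideal.Quotient.mk w.asIdeal g) ≠ 1 := by
  classical
  letI := Ideal.Quotient.field w.asIdeal
  letI := Fintype.ofFinite (𝓞 K ⧸ w.asIdeal)
  obtain ⟨γ, hγ⟩ := IsCyclic.exists_generator (α := (𝓞 K ⧸ w.asIdeal)ˣ)
  obtain ⟨g, hg⟩ := Ideal.Quotient.mk_surjective (γ : 𝓞 K ⧸ w.asIdeal)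
  refine ⟨g, fun h => γ.ne_zero (by rw [← hg]; exact Ideal.Quotient.eq_zero_iff_mem.mpr h), fun h1 => ?_⟩
  rw [hg] at h1
  obtain ⟨-, hspec⟩ := cubicResidueSymbol_spec hζ h3 γ.ne_zero
  rw [h1, map_one] at hspec
  have hord : orderOf γ = Nat.card (𝓞 K ⧸ w.asIdeal)ˣ := orderOf_eq_card_of_forall_mem_zpowers hγ
  have hcard : Nat.card (𝓞 K ⧸ w.asIdeal)ˣ = w.residueCard - 1 := by
    rw [Nat.card_units, ← HeightOneSpectrum.residueCard_eq_card_quotient]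
  have hlt : 1 < w.residueCard := by
    rw [HeightOneSpectrum.residueCard_eq_card_quotient]; exact Finite.one_lt_card
  have hdvd : orderOf γ ∣ (w.residueCard - 1) / 3 := by
    apply orderOf_dvd_of_pow_eq_one
    apply Units.ext
    rw [Units.val_pow_eq_pow_val, Units.val_one]; exact hspec.symm
  have h3dvd := three_dvd_residueCard_sub_one hζ h3
  rw [hord, hcard] at hdvd
  have hle := Nat.le_of_dvd (Nat.div_pos (Nat.le_of_dvd (by omega) h3dvd) (by norm_num)) hdvd
  omega

variable [IsCyclotomicExtension {3} ℚ K]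

include hζ in
/-- **Eisenstein reciprocity at an auxiliary prime, inert case**: `p ≡ 2 (mod 3)`, `w = (p)` (`Nw = p²`), `𝔮 = (ϖ) ∤ 3p` with
`ϖ ≡ 1 (mod 3)`; then `χ_𝔮(p) = χ_w(J(χ_𝔮,χ_𝔮)) = χ_w(−ϖ) = χ_w(ϖ) = χ_w(g)` for any `g ≡ ϖ (mod w)` (tree
`cubicResidueSymbol_natCast_eq_cubicResidueSymbol_cubicJacobiSum` + `J = −ϖ`, `cubicJacobiSum_eq_neg_of_span_eq`).
[cite: IrelandRosen1990, Ch. 9 §3 Theorem 1 and §4 (proof, case `π₁ = q ≡ 2 (3)`)] -/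
theorem cubicResidueSymbol_natCast_eq_of_residueCard_eq_sq {p : ℕ} [Fact p.Prime] (hp3 : p % 3 = 2)
    {w : HeightOneSpectrum (𝓞 K)} (hpw : (p : 𝓞 K) ∈ w.asIdeal) (hw : w.residueCard = p ^ 2)
    {𝔮 : HeightOneSpectrum (𝓞 K)} {ϖ : 𝓞 K} (hϖ : Ideal.span {ϖ} = 𝔮.asIdeal) (hϖ1 : ϖ - 1 ∈ Ideal.span {(3 : 𝓞 K)})
    (h3𝔮 : (3 : 𝓞 K) ∉ 𝔮.asIdeal) (hp𝔮 : (p : 𝓞 K) ∉ 𝔮.asIdeal) {g : 𝓞 K} (hϖg : ϖ - g ∈ w.asIdeal) :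
    cubicResidueSymbol 𝔮 (Ideal.Quotient.mk 𝔮.asIdeal p) = cubicResidueSymbol w (Ideal.Quotient.mk w.asIdeal g) := by
  have hp3' : Nat.Coprime p 3 := by
    rw [Nat.coprime_comm, Nat.Prime.coprime_iff_not_dvd (by norm_num)]; omega
  have h3w : (3 : 𝓞 K) ∉ w.asIdeal := three_not_mem_of_natCast_mem hpw hp3'
  rw [map_natCast, cubicResidueSymbol_natCast_eq_cubicResidueSymbol_cubicJacobiSum hζ hp3 hpw hw h3𝔮 hp𝔮,
    cubicJacobiSum_eq_neg_of_span_eq hζ 𝔮 h3𝔮 hϖ hϖ1, map_neg, neg_eq_neg_one_mul, cubicResidueSymbol_mul hζ,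
    cubicResidueSymbol_neg_one hζ h3w, one_mul, (Ideal.Quotient.mk_eq_mk_iff_sub_mem _ _).mpr hϖg]

include hζ in
/-- **Eisenstein reciprocity at an auxiliary prime, split case**: `p ≡ 1 (mod 3)`, `w ∣ p` of degree one, `𝔮 = (ϖ) ∤ 3p` with
`ϖ ≡ 1 (mod 3)` and `N𝔮·ϖ ≡ g² (mod w)` (`N𝔮 = ϖ·cϖ` with `cϖ ≡ 1`, `ϖ ≡ g`), `g ∉ w`; then
`χ_𝔮(p)·χ_w(N𝔮·J) = 1` with `J = −ϖ` gives `χ_𝔮(p) = χ_w(g)⁻² = χ_w(g)` (tree `cubicResidueSymbol_natCast_mul_cubicResidueSymbol_eq_one`).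
[cite: IrelandRosen1990, Ch. 9 §3 Theorem 1 and §4 (proof, case `Nπ₁ ≠ Nπ₂`)] -/
theorem cubicResidueSymbol_natCast_eq_of_residueCard_eq {p : ℕ} [Fact p.Prime] (hp3 : p % 3 = 1)
    {w : HeightOneSpectrum (𝓞 K)} (hpw : (p : 𝓞 K) ∈ w.asIdeal) (hw : w.residueCard = p)
    {𝔮 : HeightOneSpectrum (𝓞 K)} {ϖ : 𝓞 K} (hϖ : Ideal.span {ϖ} = 𝔮.asIdeal) (hϖ1 : ϖ - 1 ∈ Ideal.span {(3 : 𝓞 K)})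
    (h3𝔮 : (3 : 𝓞 K) ∉ 𝔮.asIdeal) (hp𝔮 : (p : 𝓞 K) ∉ 𝔮.asIdeal) {g : 𝓞 K} (hg : g ∉ w.asIdeal)
    (hN : (𝔮.residueCard : 𝓞 K) * ϖ - g ^ 2 ∈ w.asIdeal) :
    cubicResidueSymbol 𝔮 (Ideal.Quotient.mk 𝔮.asIdeal p) = cubicResidueSymbol w (Ideal.Quotient.mk w.asIdeal g) := by
  have hp3' : Nat.Coprime p 3 := by
    rw [Nat.coprime_comm, Nat.Prime.coprime_iff_not_dvd (by norm_num)]; omega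
  have h3w : (3 : 𝓞 K) ∉ w.asIdeal := three_not_mem_of_natCast_mem hpw hp3'
  have h := cubicResidueSymbol_natCast_mul_cubicResidueSymbol_eq_one hζ hp3 hpw hw h3𝔮 hp𝔮
  rw [cubicJacobiSum_eq_neg_of_span_eq hζ 𝔮 h3𝔮 hϖ hϖ1, mul_neg, map_neg, neg_eq_neg_one_mul, cubicResidueSymbol_mul hζ,
    cubicResidueSymbol_neg_one hζ h3w, one_mul, (Ideal.Quotient.mk_eq_mk_iff_sub_mem _ _).mpr hN, map_pow, sq,
    cubicResidueSymbol_mul hζ] at h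
  have hg0 : Ideal.Quotient.mk w.asIdeal g ≠ 0 := fun h0 => hg (Ideal.Quotient.eq_zero_iff_mem.mp h0)
  have hg3 := (cubicResidueSymbol_spec hζ h3w hg0).1
  set x := cubicResidueSymbol w (Ideal.Quotient.mk w.asIdeal g)
  rw [map_natCast]
  calc cubicResidueSymbol 𝔮 (p : 𝓞 K ⧸ 𝔮.asIdeal)
      = cubicResidueSymbol 𝔮 (p : 𝓞 K ⧸ 𝔮.asIdeal) * (x * x) * x := by
        rw [mul_assoc, show x * x * x = x ^ 3 by ring, hg3, mul_one]
    _ = x := by rw [h, one_mul]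

include hζ in
/-- ★★ **The cubic symbol of `D = p^v·m` at an auxiliary prime**: for a rational prime `p ≠ 3`, `D = p^v m` with `p ∤` … (only
`m ≠ 0` is used), `𝔮 = (ϖ) ∌ p` with `ϖ ≡ 1 (mod 9m)`, a prime `w ∋ p` and `g ∉ w` with `ϖ ≡ g (mod w)` (and, when `w` has degree one,
`N𝔮·ϖ ≡ g² (mod w)`): `χ_𝔮(D) = χ_w(g)^v` — the cofactor `m` dies by periodicity (`cubicResidueSymbol_eq_one_of_sub_one_mem`) and
`χ_𝔮(p) = χ_w(g)` by Eisenstein reciprocity (inert / split).  Stated for a general `D` (the sextic twists use `D = 4k`; the good-at-`2`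
class uses an odd `D`). [cite: IrelandRosen1990, Ch. 9 §3 Theorem 1; Ch. 18 §7 (proof of Theorem 4′)] -/
theorem cubicResidueSymbol_intCast_eq_pow {D m : ℤ} {p v : ℕ} [Fact p.Prime] (hp3 : p ≠ 3) (hDm : D = (p : ℤ) ^ v * m)
    {𝔮 : HeightOneSpectrum (𝓞 K)} {ϖ : 𝓞 K} (hϖ : Ideal.span {ϖ} = 𝔮.asIdeal)
    (hϖ1 : ϖ - 1 ∈ Ideal.span {((9 * m : ℤ) : 𝓞 K)}) (hp𝔮 : (p : 𝓞 K) ∉ 𝔮.asIdeal)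
    {w : HeightOneSpectrum (𝓞 K)} (hpw : (p : 𝓞 K) ∈ w.asIdeal) {g : 𝓞 K} (hg : g ∉ w.asIdeal) (hϖg : ϖ - g ∈ w.asIdeal)
    (hN : w.residueCard = p → (𝔮.residueCard : 𝓞 K) * ϖ - g ^ 2 ∈ w.asIdeal) :
    cubicResidueSymbol 𝔮 (Ideal.Quotient.mk 𝔮.asIdeal (D : 𝓞 K)) = cubicResidueSymbol w (Ideal.Quotient.mk w.asIdeal g) ^ v := by
  have hp := (Fact.out : p.Prime)
  have h9 : ((9 * m : ℤ) : 𝓞 K) = 9 * (m : 𝓞 K) := by push_cast; ring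
  rw [h9] at hϖ1
  obtain ⟨h3𝔮, -, hχm⟩ := cubicResidueSymbol_eq_one_of_sub_one_mem hζ hϖ hϖ1
  have hϖ3 : ϖ - 1 ∈ Ideal.span {(3 : 𝓞 K)} :=
    Ideal.span_singleton_le_span_singleton.mpr ⟨3 * (m : 𝓞 K), by ring⟩ hϖ1
  have hχp : cubicResidueSymbol 𝔮 (Ideal.Quotient.mk 𝔮.asIdeal p) = cubicResidueSymbol w (Ideal.Quotient.mk w.asIdeal g) := by
    have h3 : p % 3 = 1 ∨ p % 3 = 2 := by
      have h0 : p % 3 ≠ 0 := fun h => hp3 ((Nat.prime_dvd_prime_iff_eq Nat.prime_three hp).mp (Nat.dvd_of_mod_eq_zero h)).symm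
      omega
    rcases h3 with h1 | h2
    · have hw := residueCard_eq_of_mod_three_eq_one hp h1 hpw
      exact cubicResidueSymbol_natCast_eq_of_residueCard_eq hζ h1 hpw hw hϖ hϖ3 h3𝔮 hp𝔮 hg (hN hw)
    · have hw : w.residueCard = p ^ 2 := by
        rw [show w.residueCard = Ideal.absNorm w.asIdeal from rfl, asIdeal_eq_span_of_mod_three_eq_two hp h2 hpw,
          show ((p : ℕ) : 𝓞 K) = ((p : ℤ) : 𝓞 K) by push_cast; rfl, absNorm_span_intCast, Int.natAbs_natCast]
      exact cubicResidueSymbol_natCast_eq_of_residueCard_eq_sq hζ h2 hpw hw hϖ hϖ3 h3𝔮 hp𝔮 hϖg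
  rw [hDm]
  push_cast
  rw [map_mul, map_pow, cubicResidueSymbol_mul hζ, hχm, mul_one, cubicResidueSymbol_pow hζ h3𝔮, hχp]

end Cubic

end Literature.NumberTheory.GaloisRepresentations.EisensteinSextic

end
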